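import Summits.Ventures.AbcSig.Rows.XTemplateC2a
import Summits.Ventures.AbcSig.Levels.N1696
import Summits.Ventures.AbcSig.Levels.N106

/-!
# Venture AbcSig — ROW `C2aL53A0V2`: `xⁿ + 53^m·yⁿ = z²`, class `a = 0`, over the level files 1696 (ordinary tree certificates) and 106 (ordinary tree certificates) (GENERATED by p-lean g4 `gen4/c2arow2.py`)

HONEST FRAMING. A row of a COMPUTATION cell (`pub-abcsig`); a CONDITIONAL theorem, no claim on ABC or any summit.
Hypotheses: `BS04Package` (CITED: [BS04] Lemma 3.3 + (3.1) + Lemma 4.2); `DataComplete` at both levels and `RefinesCPSymAll` at the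
norm-form level(s) (COMPUTED: certified engine-1 level files; `Sieve/CharpolyCert.lean` / `Sieve/CharpolyTwist.lean`);
and the listed per-orbit exclusions `hX_…` (CITED: the row of record's module closures — M4 Kraus / M6 / M8 / [BS04, Prop 4.4/4.6] as its R3
names them; nothing of those is checked here). Exponent range: prime `n ≥ 11`, `n ≠ 53`; `B = 2^0·53^m`, `1 ≤ m < n`
(RULING H1 reduced exponents).
v2 (T-BS13 revision): the v1 Lean row Rows/C2aL53A0.lean keeps its larger residual; this file matches the superseding row of record.
Row of record: `census/rows/T-BS13/C2a-l53-a0.md` (sha16 `cace2ecd2c3b9c8f`; v2 row of record (supersession), R8-signed; see the row's R8 cell).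
-/

namespace Summit.Ventures.AbcSig

/-- Row `C2aL53A0V2`: class `a = 0`, first distribution, prime `n ≥ 11`, `n ≠ 53`; conditional on the named hypotheses. -/
theorem xrow_C2aL53A0V2 (M : NewformModel) (hP : M.BS04Package)
    (hD1696 : M.DataComplete 1696 level1696Orbits)
    (hD106 : M.DataComplete 106 level106Orbits)
    (n : ℕ) (hn : n.Prime) (hmin : 11 ≤ n) (hnℓ : n ≠ 53) (m : ℕ) (hm : 1 ≤ m) (hmn : m < n)
    (hX_orbit_1696_12 : n ∈ ([17] : List ℕ) → M.Excludes 1696 orbit_1696_12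
      (famB (2 ^ 0 * 53 ^ m) n (fun _ _ => True)))
    (x y z : ℤ) (hxy1 : x * y ≠ 1) (hxy2 : x * y ≠ -1) : ¬ IsPrimitiveSolution 1 (2 ^ 0 * 53 ^ m) 1 n x y z := by
  have hℓ : Nat.Prime 53 := by norm_num
  have h7 : 7 ≤ n := by omega
  exact xrowC2a_a0 53 hℓ (by norm_num) M hP n hn h7 hnℓ hD1696 hD106 m hm hmn
    (level1696_sieve n hn h7 (fun o => M.Excludes 1696 o
      (famB (2 ^ 0 * 53 ^ m) n (fun _ _ => True)) ∨ M.ExcludesStd 1696 o n) (fun hmem => by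
      obtain rfl : n = 7 := by simpa using hmem
      omega) (fun hmem => by
      obtain rfl : n = 7 := by simpa using hmem
      omega) (fun hmem => by
      obtain rfl : n = 7 := by simpa using hmem
      omega) (fun hmem => by
      obtain rfl : n = 7 := by simpa using hmem
      omega) (fun hmem => by
      obtain rfl : n = 7 := by simpa using hmem
      omega) (fun hmem => by
      obtain rfl : n = 7 := by simpa using hmem
      omega) (fun hmem => by
      obtain rfl : n = 7 := by simpa using hmem
      omega) (fun hmem => by
      obtain rfl : n = 17 := by simpa using hmem
      exact Or.inl (hX_orbit_1696_12 (by simp))) (fun hmem => by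
      obtain rfl : n = 7 := by simpa using hmem
      omega))
    (level106_sieve n hn h7 (fun o => M.Excludes 106 o
      (famB (2 ^ 0 * 53 ^ m) n (fun _ _ => True)) ∨ M.ExcludesStd 106 o n) (fun hmem => by
      obtain rfl : n = 7 := by simpa using hmem
      omega) (fun hmem => by
      obtain rfl : n = 7 := by simpa using hmem
      omega))
    x y z hxy1 hxy2

end Summit.Ventures.AbcSig
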